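import Mathlib
import Summits.KontsevichZagierPeriods.KontsevichZagierPeriods.Theorems.SoloInformedEulerLemniscate
import Summits.KontsevichZagierPeriods.KontsevichZagierPeriods.Theorems.SoloInformedLemniscateValues
import HarnessLib
import HarnessLib.Audit

/-!
# SoloInformed — the lemniscate sector of the Kontsevich–Zagier conjecture is decided (Theorem IX)

Let `u = ⟦β(¼,½)⟧`, `v = ⟦β(¾,½)⟧`, `w = ⟦[disc, 1]⟧ = ⟦π⟧` be the classes, in the formal period
ring `P = KZ.FormalPeriodRing` (integral representations modulo the three Kontsevich–Zagier
moves), of Euler's Beta representations `[(0,1), t^{−3/4}(1−t)^{−1/2}]`,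
`[(0,1), t^{−1/4}(1−t)^{−1/2}]` (four times the two periods `∫₀¹dx/√(1−x⁴)`, `∫₀¹x²dx/√(1−x⁴)` of
the lemniscatic curve `y² = 1 − x⁴`) and of KZ's representation of `π`.  The **lemniscate
sector** is the sub-ring `A = ℤ[u, v, w] ⊆ P`.

**Theorem IX** (`soloInformed_kzp_on_lemniscateSector`). *The Kontsevich–Zagier period conjecture
holds on `A`: two integral representations (of any dimensions) whose classes lie in `A` and whose
values agree are equivalent under the three moves.*  Equivalently
(`soloInformed_lemniscateSector_relation_derivable`): every polynomial relation with integer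
coefficients among the real numbers `B(¼,½)`, `B(¾,½)`, `π` is derivable by the moves; and
(`soloInformed_evalP_eq_zero_of_mem_lemniscateSector`) the evaluation map `A → ℝ` is injective, so
`A ⊗ ℚ = ℚ[u, v]` is a polynomial ring in two variables and the relation ideal of `(u, v, w)` over
`ℚ` is generated by Euler's relation `uv − 4w`.

Proof = (a) + (b): (a) `u·v = 4·w` in `P` — Euler's relation DERIVED inside the rules
(`soloInformed_euler_lemniscate`, file `SoloInformedEulerLemniscate.lean`: Dirichlet's two charts,
the disc peeling, `β(¼,1) ∼ [pt,4]`); (b) `B(¼,½), B(¾,½)` algebraically independent over `ℚ`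
(`soloInformed_algebraicIndependent_betaQuarter_betaThreeQuarter`, from Chudnovsky's theorem on
`π, Γ(¼)` — a tree theorem — file `SoloInformedLemniscateValues.lean`); then for `x ∈ A` some
`4ᴺx ∈ ℤ[u,v]`, on which evaluation is injective by (b), and `4` is a unit of `P`
(`4·⟦[pt,¼]⟧ = 1`).

Place in the paper (§6octies): the conjecture is `KZP ⟺ GPC ∧ PiCancellation` (kernel halves
landed); sector by sector it says "evaluation is injective on the sub-ring".  Every previously
decided sector (Rungs 1–2, the length faces) carried only LINEAR relations; this is the first
decided sector with a genuinely QUADRATIC period relation (the cup product on `H¹` of the CM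
elliptic curve `y² = 1 − x⁴`, i.e. Legendre's relation at the CM point), and its transcendence
input is exactly Grothendieck's period conjecture for that `H¹` (Chudnovsky), as the census of §8
predicts a Rung-3 engine must be.  Residency `solo-KontsevichZagierPeriods-informed` (s22).

References: M. Kontsevich, D. Zagier, *Periods* (2001), §1.1 (6), §1.2, §4.1; G. V. Chudnovsky
(1984), Ch. 7;
A. Huber, G. Wüstholz, *Transcendence and linear relations of 1-periods* (2022), §13.
-/

noncomputable section

open MeasureTheory Set Filter
namespace Summit.KontsevichZagierPeriods.KontsevichZagierPeriods.Theorems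

open Literature.NumberTheory.Transcendental Literature.NumberTheory.Transcendental.KZ
open Literature.ModelTheory.ExponentialFields

/-! ### Arithmetic of the formal period ring: `4` is a unit; the `4ᴺ`-lemma -/

/-- **`4` is a unit of the formal period ring**: `4 · ⟦[pt, ¼]⟧ = 1`
(`KZ.natCast_add_one_mul_toFormalPeriod_of_unit_constMul_inv`). [Kontsevich–Zagier 2001, §4.1] -/
theorem soloInformed_isUnit_four : IsUnit (4 : FormalPeriodRing) := by
  have h : IsAlgebraic ℚ (((3 : ℝ) + 1)⁻¹) := by
    rw [show ((3 : ℝ) + 1)⁻¹ = (((4 : ℚ)⁻¹ : ℚ) : ℝ) by push_cast; norm_num]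
    exact isAlgebraic_algebraMap _
  have e := natCast_add_one_mul_toFormalPeriod_of_unit_constMul_inv 3 h
  rw [show ((3 : ℕ) : FormalPeriodRing) + 1 = 4 by norm_num] at e
  exact IsUnit.of_mul_eq_one _ e

/-- **The `4ᴺ`-lemma**: if `u·v = 4·w`, every element of `ℤ[u, v, w]` has a multiple `4ᴺ·x` in
`ℤ[u, v]` (induction over `Algebra.adjoin`). [folklore] -/
theorem soloInformed_pow_four_mul_mem_adjoin_pair {u v w : FormalPeriodRing} (huvw : u * v = 4 * w)
    {x : FormalPeriodRing} (hx : x ∈ Algebra.adjoin ℤ ({u, v, w} : Set FormalPeriodRing)) :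
    ∃ N : ℕ, (4 : FormalPeriodRing) ^ N * x ∈ Algebra.adjoin ℤ ({u, v} : Set FormalPeriodRing) := by
  induction hx using Algebra.adjoin_induction with
  | mem y hy =>
    rcases hy with rfl | rfl | rfl
    · exact ⟨0, by simpa using Algebra.subset_adjoin (by simp)⟩
    · exact ⟨0, by simpa using Algebra.subset_adjoin (by simp)⟩
    · refine ⟨1, ?_⟩
      rw [pow_one, ← huvw]
      exact mul_mem (Algebra.subset_adjoin (by simp)) (Algebra.subset_adjoin (by simp))
  | algebraMap r => exact ⟨0, by rw [pow_zero, one_mul]; exact Subalgebra.algebraMap_mem _ r⟩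
  | add y z _ _ hy hz =>
    obtain ⟨N₁, h₁⟩ := hy
    obtain ⟨N₂, h₂⟩ := hz
    refine ⟨N₁ + N₂, ?_⟩
    have : (4 : FormalPeriodRing) ^ (N₁ + N₂) * (y + z) =
        4 ^ N₂ * (4 ^ N₁ * y) + 4 ^ N₁ * (4 ^ N₂ * z) := by ring
    rw [this]
    exact add_mem (mul_mem (pow_mem (ofNat_mem _ 4) N₂) h₁)
      (mul_mem (pow_mem (ofNat_mem _ 4) N₁) h₂)
  | mul y z _ _ hy hz =>
    obtain ⟨N₁, h₁⟩ := hy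
    obtain ⟨N₂, h₂⟩ := hz
    refine ⟨N₁ + N₂, ?_⟩
    have : (4 : FormalPeriodRing) ^ (N₁ + N₂) * (y * z) = (4 ^ N₁ * y) * (4 ^ N₂ * z) := by ring
    rw [this]
    exact mul_mem h₁ h₂

/-- Evaluation commutes with polynomial expressions in classes: `evalP (p(c)) = p(evalP ∘ c)`. -/
theorem soloInformed_evalP_aeval {k : ℕ} (c : Fin k → FormalPeriodRing)
    (p : MvPolynomial (Fin k) ℤ) :
    evalP (MvPolynomial.aeval c p) = MvPolynomial.aeval (fun i => evalP (c i)) p := by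
  have h := MvPolynomial.comp_aeval_apply (f := c) evalP.toIntAlgHom p
  simpa using h

/-- **Injectivity of evaluation on `ℤ[u, v]`** when the values of `u, v` are algebraically
independent over `ℚ`. [folklore] -/
theorem soloInformed_evalP_eq_zero_of_mem_adjoin_pair {u v : FormalPeriodRing}
    (h : AlgebraicIndependent ℚ ![evalP u, evalP v]) {x : FormalPeriodRing}
    (hx : x ∈ Algebra.adjoin ℤ ({u, v} : Set FormalPeriodRing)) (h0 : evalP x = 0) : x = 0 := by
  have hZ : AlgebraicIndependent ℤ ![evalP u, evalP v] :=
    h.restrictScalars (algebraMap ℤ ℚ).injective_int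
  have hx' :
      x ∈ (MvPolynomial.aeval ![u, v] : MvPolynomial (Fin 2) ℤ →ₐ[ℤ] FormalPeriodRing).range := by
    rwa [← Algebra.adjoin_range_eq_range_aeval, Matrix.range_cons_cons_empty]
  obtain ⟨p, rfl⟩ := (AlgHom.mem_range _).mp hx'
  have h1 : MvPolynomial.aeval ![evalP u, evalP v] p = 0 := by
    have hfun : (fun i => evalP (![u, v] i)) = ![evalP u, evalP v] := by
      ext i; fin_cases i <;> rfl
    rw [← hfun, ← soloInformed_evalP_aeval, h0]
  have hinj : Function.Injective
      (MvPolynomial.aeval ![evalP u, evalP v] : MvPolynomial (Fin 2) ℤ →ₐ[ℤ] ℝ) := hZ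
  have hp : p = 0 := hinj (h1.trans (map_zero _).symm)
  rw [hp, map_zero]

/-! ### The lemniscate sector -/

section Sector

variable (B₁ B₃ : IntegralRep 1)

/-- **The lemniscate sector** `A = ℤ[⟦β(¼,½)⟧, ⟦β(¾,½)⟧, ⟦π⟧] ⊆ P` of the formal period ring, for
representations `B₁, B₃` pinned as the two Beta integrals and KZ's `[disc, 1]`. -/
def soloInformedLemniscateSector : Subalgebra ℤ FormalPeriodRing :=
  Algebra.adjoin ℤ {toFormalPeriod (of B₁), toFormalPeriod (of B₃), toFormalPeriod (of KZ.piRep)}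

/-- **`B(¼,½)` and `B(¾,½)` are algebraically independent over `ℚ`**: `ℚ(B(¼,½), B(¾,½)) ∋ π`
because `B(¼,½)B(¾,½) = 4π` (value of the DERIVED relation `soloInformed_euler_lemniscate`), and
`B(¼,½), π` are algebraically independent (Chudnovsky). [Chudnovsky 1984, Ch. 7, Cor. 2.3] -/
theorem soloInformed_algebraicIndependent_betaQuarter_betaThreeQuarter
    (h₁d : B₁.domain = {t | t 0 ∈ Set.Ioo (0:ℝ) 1})
    (h₁i : Set.EqOn B₁.integrand
      (fun t => (t 0) ^ (((1 / 4 : ℚ) : ℝ) - 1) * (1 - t 0) ^ (((1 / 2 : ℚ) : ℝ) - 1)) B₁.domain)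
    (h₃d : B₃.domain = {t | t 0 ∈ Set.Ioo (0:ℝ) 1})
    (h₃i : Set.EqOn B₃.integrand
      (fun t => (t 0) ^ (((3 / 4 : ℚ) : ℝ) - 1) * (1 - t 0) ^ (((1 / 2 : ℚ) : ℝ) - 1)) B₃.domain) :
    AlgebraicIndependent ℚ ![B₁.value, B₃.value] := by
  have hprod := soloInformed_value_betaQuarter_mul_value_betaThreeQuarter B₁ B₃ h₁d h₁i h₃d h₃i
  set K : IntermediateField ℚ ℝ := IntermediateField.adjoin ℚ ({B₁.value, B₃.value} : Set ℝ)
    with hK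
  have h1K : B₁.value ∈ K := IntermediateField.subset_adjoin ℚ _ (by simp)
  have h3K : B₃.value ∈ K := IntermediateField.subset_adjoin ℚ _ (by simp)
  refine soloInformed_algebraicIndependent_pair_transfer
    (soloInformed_algebraicIndependent_betaQuarterHalf_pi B₁ h₁d h₁i)
    ⟨1, one_pos, by simpa using h1K⟩
    ⟨1, one_pos, ?_⟩
  rw [pow_one, show Real.pi = B₁.value * B₃.value / 4 by rw [hprod]; ring]
  exact div_mem (mul_mem h1K h3K) (by exact_mod_cast K.natCast_mem 4)

/-- **`B(¾,½)` is transcendental** (`= (2π)^{3/2}·2/Γ(¼)²`). [Chudnovsky 1984, Ch. 7] -/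
theorem soloInformed_transcendental_betaThreeQuarterHalf
    (h₁d : B₁.domain = {t | t 0 ∈ Set.Ioo (0:ℝ) 1})
    (h₁i : Set.EqOn B₁.integrand
      (fun t => (t 0) ^ (((1 / 4 : ℚ) : ℝ) - 1) * (1 - t 0) ^ (((1 / 2 : ℚ) : ℝ) - 1)) B₁.domain)
    (h₃d : B₃.domain = {t | t 0 ∈ Set.Ioo (0:ℝ) 1})
    (h₃i : Set.EqOn B₃.integrand
      (fun t => (t 0) ^ (((3 / 4 : ℚ) : ℝ) - 1) * (1 - t 0) ^ (((1 / 2 : ℚ) : ℝ) - 1)) B₃.domain) :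
    Transcendental ℚ B₃.value := by
  simpa using
    (soloInformed_algebraicIndependent_betaQuarter_betaThreeQuarter B₁ B₃ h₁d h₁i h₃d
      h₃i).transcendental 1

/-- **Evaluation is injective on the lemniscate sector**: an element of
`ℤ[⟦β(¼,½)⟧, ⟦β(¾,½)⟧, ⟦π⟧]` of value `0` is `0` in `P` (the `4ᴺ`-lemma along `u·v = 4·w`,
injectivity on `ℤ[u,v]` by algebraic independence, and `4 ∈ Pˣ`). -/
theorem soloInformed_evalP_eq_zero_of_mem_lemniscateSector
    (h₁d : B₁.domain = {t | t 0 ∈ Set.Ioo (0:ℝ) 1})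
    (h₁i : Set.EqOn B₁.integrand
      (fun t => (t 0) ^ (((1 / 4 : ℚ) : ℝ) - 1) * (1 - t 0) ^ (((1 / 2 : ℚ) : ℝ) - 1)) B₁.domain)
    (h₃d : B₃.domain = {t | t 0 ∈ Set.Ioo (0:ℝ) 1})
    (h₃i : Set.EqOn B₃.integrand
      (fun t => (t 0) ^ (((3 / 4 : ℚ) : ℝ) - 1) * (1 - t 0) ^ (((1 / 2 : ℚ) : ℝ) - 1)) B₃.domain)
    {x : FormalPeriodRing} (hx : x ∈ soloInformedLemniscateSector B₁ B₃) (h0 : evalP x = 0) :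
    x = 0 := by
  have huvw : toFormalPeriod (of B₁) * toFormalPeriod (of B₃) = 4 * toFormalPeriod (of KZ.piRep) :=
    soloInformed_euler_lemniscate B₁ B₃ h₁d h₁i h₃d h₃i
  obtain ⟨N, hN⟩ := soloInformed_pow_four_mul_mem_adjoin_pair huvw hx
  have hind : AlgebraicIndependent ℚ
      ![evalP (toFormalPeriod (of B₁)), evalP (toFormalPeriod (of B₃))] := by
    rw [evalP_toFormalPeriod_of, evalP_toFormalPeriod_of]
    exact soloInformed_algebraicIndependent_betaQuarter_betaThreeQuarter B₁ B₃ h₁d h₁i h₃d h₃i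
  have h4 : evalP ((4 : FormalPeriodRing) ^ N * x) = 0 := by rw [map_mul, h0, mul_zero]
  have h5 := soloInformed_evalP_eq_zero_of_mem_adjoin_pair hind hN h4
  exact (soloInformed_isUnit_four.pow N).mul_right_eq_zero.mp h5

/-- **Theorem IX — the Kontsevich–Zagier conjecture holds on the lemniscate sector.** Two integral
representations, of any dimensions, whose classes lie in `ℤ[⟦β(¼,½)⟧, ⟦β(¾,½)⟧, ⟦π⟧] ⊆ P` and whose
values agree are equivalent under the three Kontsevich–Zagier moves.
[Kontsevich–Zagier 2001, §1.2, Conjecture 1 — this sector] -/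
theorem soloInformed_kzp_on_lemniscateSector
    (h₁d : B₁.domain = {t | t 0 ∈ Set.Ioo (0:ℝ) 1})
    (h₁i : Set.EqOn B₁.integrand
      (fun t => (t 0) ^ (((1 / 4 : ℚ) : ℝ) - 1) * (1 - t 0) ^ (((1 / 2 : ℚ) : ℝ) - 1)) B₁.domain)
    (h₃d : B₃.domain = {t | t 0 ∈ Set.Ioo (0:ℝ) 1})
    (h₃i : Set.EqOn B₃.integrand
      (fun t => (t 0) ^ (((3 / 4 : ℚ) : ℝ) - 1) * (1 - t 0) ^ (((1 / 2 : ℚ) : ℝ) - 1)) B₃.domain)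
    {n m : ℕ} (r : IntegralRep n) (r' : IntegralRep m)
    (hr : toFormalPeriod (of r) ∈ soloInformedLemniscateSector B₁ B₃)
    (hr' : toFormalPeriod (of r') ∈ soloInformedLemniscateSector B₁ B₃)
    (hv : r.value = r'.value) : Equivalent r r' := by
  have hx : toFormalPeriod (of r) - toFormalPeriod (of r') ∈ soloInformedLemniscateSector B₁ B₃ :=
    sub_mem hr hr'
  have h0 : evalP (toFormalPeriod (of r) - toFormalPeriod (of r')) = 0 := by
    rw [map_sub, evalP_toFormalPeriod_of, evalP_toFormalPeriod_of, hv, sub_self]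
  have h := soloInformed_evalP_eq_zero_of_mem_lemniscateSector B₁ B₃ h₁d h₁i h₃d h₃i hx h0
  exact toFormalPeriod_eq_iff.mp (sub_eq_zero.mp h)

/-- **Every integer polynomial relation among `B(¼,½), B(¾,½), π` is derivable by the moves**: if
`p(B(¼,½), B(¾,½), π) = 0` for `p ∈ ℤ[X, Y, Z]`, then `p(⟦β(¼,½)⟧, ⟦β(¾,½)⟧, ⟦π⟧) = 0` in `P`
(so `p ∈ (XY − 4Z)` up to `4`-saturation: the relation ideal of the sector is generated by Euler's
relation). [Kontsevich–Zagier 2001, §1.2] -/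
theorem soloInformed_lemniscateSector_relation_derivable
    (h₁d : B₁.domain = {t | t 0 ∈ Set.Ioo (0:ℝ) 1})
    (h₁i : Set.EqOn B₁.integrand
      (fun t => (t 0) ^ (((1 / 4 : ℚ) : ℝ) - 1) * (1 - t 0) ^ (((1 / 2 : ℚ) : ℝ) - 1)) B₁.domain)
    (h₃d : B₃.domain = {t | t 0 ∈ Set.Ioo (0:ℝ) 1})
    (h₃i : Set.EqOn B₃.integrand
      (fun t => (t 0) ^ (((3 / 4 : ℚ) : ℝ) - 1) * (1 - t 0) ^ (((1 / 2 : ℚ) : ℝ) - 1)) B₃.domain)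
    (p : MvPolynomial (Fin 3) ℤ) (hp : MvPolynomial.aeval ![B₁.value, B₃.value, Real.pi] p = 0) :
    MvPolynomial.aeval
      ![toFormalPeriod (of B₁), toFormalPeriod (of B₃), toFormalPeriod (of KZ.piRep)] p = 0 := by
  set c : Fin 3 → FormalPeriodRing :=
    ![toFormalPeriod (of B₁), toFormalPeriod (of B₃), toFormalPeriod (of KZ.piRep)] with hc
  have hmem : MvPolynomial.aeval c p ∈ soloInformedLemniscateSector B₁ B₃ := by
    have h1 : MvPolynomial.aeval c p ∈ Algebra.adjoin ℤ (Set.range c) := by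
      rw [Algebra.adjoin_range_eq_range_aeval]
      exact ⟨p, rfl⟩
    refine Algebra.adjoin_mono ?_ h1
    rintro _ ⟨i, rfl⟩
    fin_cases i <;> simp [hc]
  refine soloInformed_evalP_eq_zero_of_mem_lemniscateSector B₁ B₃ h₁d h₁i h₃d h₃i hmem ?_
  have hfun : (fun i => evalP (c i)) = ![B₁.value, B₃.value, Real.pi] := by
    ext i; fin_cases i <;> simp [hc, piRep_value]
  rw [soloInformed_evalP_aeval, hfun, hp]

/-- The sector is not empty of content: the two Beta representations themselves are NOT equivalent
(their values `B(¼,½) ≠ B(¾,½)` differ, being algebraically independent), while e.g.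
`[β(¼,½)] × [β(¾,½)]` and `4·[disc]` ARE (Theorem IX applies). -/
theorem soloInformed_betaQuarter_not_equivalent_betaThreeQuarter
    (h₁d : B₁.domain = {t | t 0 ∈ Set.Ioo (0:ℝ) 1})
    (h₁i : Set.EqOn B₁.integrand
      (fun t => (t 0) ^ (((1 / 4 : ℚ) : ℝ) - 1) * (1 - t 0) ^ (((1 / 2 : ℚ) : ℝ) - 1)) B₁.domain)
    (h₃d : B₃.domain = {t | t 0 ∈ Set.Ioo (0:ℝ) 1})
    (h₃i : Set.EqOn B₃.integrand
      (fun t => (t 0) ^ (((3 / 4 : ℚ) : ℝ) - 1) * (1 - t 0) ^ (((1 / 2 : ℚ) : ℝ) - 1)) B₃.domain) :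
    ¬ Equivalent B₁ B₃ := by
  intro h
  have hv : B₁.value = B₃.value := Equivalent.value_eq_holds h
  have hind := soloInformed_algebraicIndependent_betaQuarter_betaThreeQuarter B₁ B₃ h₁d h₁i h₃d h₃i
  have hinj := hind.injective
  have : (0 : Fin 2) = 1 := hinj (by simp [hv])
  exact absurd this (by decide)

end Sector

end Summit.KontsevichZagierPeriods.KontsevichZagierPeriods.Theorems

end
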